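import Mathlib
import Summits.CriticalPhenomena.CardyFormulaZ2.Theorems.CardySelfRefinementDefs
import Summits.CriticalPhenomena.CardyFormulaZ2.Theorems.CardySelfRefinementRussoDriftModel
import Summits.CriticalPhenomena.CardyFormulaZ2.Theorems.CardySelfRefinementRussoDriftPolynomial
import Literature.Probability.Percolation.SelfRefinementMeasure
import Summits.CriticalPhenomena.CardyFormulaZ2.Theorems.CardySelfRefinementGradientComparabilityStubComparabilityFixedMesh
import Summits.CriticalPhenomena.CardyFormulaZ2.Theorems.CardySelfRefinementGradientComparabilityStubDcPosOfNonconstant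
import Summits.CriticalPhenomena.CardyFormulaZ2.Theorems.CardySelfRefinementGradientComparabilityStubBoundaryValues
import Summits.CriticalPhenomena.CardyFormulaZ2.Theorems.CardySelfRefinementGradientComparabilityStubPathPointLower
import Summits.CriticalPhenomena.CardyFormulaZ2.Theorems.CardySelfRefinementGradientComparabilityStubPathPointUpper
import HarnessLib

/-!
# `GradientComparability`, line `Sketch`: Kesten's dictionary along the path from the kernels W, R

Route `CardySelfRefinement`, sub-problem `CriticalPhenomena/CardyFormulaZ2`; crux `GradientComparability`
(stmt-CriticalPhenomena-10269), line `Sketch` (card `Ideas/level-curve-window-transport.md`).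
Vocabulary (`M A P Dρ Dc PathOK`, `Aloc`, …) from `CardySelfRefinementDefs` (definitionally the
route's `let`-chain).  The crux: for `k ∈ {2,3}`, every RSW path `γ : (1,0) → (0,½)` of the
self-refinement model `M_k(ρ,c)` and every nonempty finite quad family `F`, the Russo-gradient size
`G(η,q) = |∂ρP| + |∂cP|` is (i) comparable up to one constant between any two path points at equal
small mesh and (ii) tends to `+∞` uniformly along the path.

These `…Kernels*` files are the KERNEL-CHECKED REDUCTION of the crux to the four OPEN registered
stubs of the line (its research kernels), taken as section hypotheses with the stubs' literal
signatures: BET = `stub_transversalSlopeLipschitz` (`hBET`), W = `stub_Dc_windowStability` (`hW`),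
R = `stub_Drho_le_window` (`hR`), CORNER = `stub_cornerTwoCharts` (`hCorner`); every other input of
the line is PROVED in the tree and imported.

## This file (1/3): the bulk dictionary

* `P_mono_c` — `P_η(ρ,·)` is monotone (stochastic monotonicity of `M_k(ρ,·)` on the increasing
  cylinder `Aloc`);
* `kestenDictionary` — `G(η, γ s) ≍ 1/(cp − cm)(ρ_s)` at bulk path points, mesh-uniformly, from
  W ⨉ R ⨉ uniform non-degeneracy along the path (`stub_pathPoint_lower/upper`, proved), glued by
  the MEAN VALUE THEOREM: a window point `ct ∈ (cm, cp)` has `∂cP(ρ_s, ct) = (vhi − vlo)/(cp − cm)`;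
* `kestenWindowAlongPath` — the dictionary packaged with the boundary values (`stub_boundaryValues`,
  proved) and positivity of `∂cP` on the window (`stub_Dc_pos_of_nonconstant`, proved).
-/

noncomputable section

namespace Summit.CriticalPhenomena.CardyFormulaZ2.Theorems.CardySelfRefinement

open scoped Topology
open Filter Set MeasureTheory
open Literature.Probability.LatticeModels Literature.Probability.Percolation
open Literature.Probability.Percolation.QuadCrossing
open Summit.CriticalPhenomena.CardyFormulaZ2.Theses.CardySelfRefinement

/-- `P` is monotone in `c` (for `η ≠ 0`): `M_k(ρ,·)` is stochastically increasing on increasing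
measurable events (`selfRefinementMeasure_real_mono_right`) and `P = M_k(Aloc)` with `Aloc` an
increasing finite cylinder. -/
theorem P_mono_c (k m : ℕ) (F : Fin m → Quad (Set.univ : Set ℂ)) {η : ℝ} (hη : η ≠ 0) (ρ : ℝ)
    {c c' : ℝ} (hcc' : c ≤ c') : P k m F η ρ c ≤ P k m F η ρ c' := by
  rw [P_eq_real_Aloc, P_eq_real_Aloc]
  exact selfRefinementMeasure_real_mono_right k ρ hcc' (isUpperSet_Aloc m F η) (measurableSet_Aloc m F hη)

/-! ### (DICT) Kesten's dictionary along the path — reshaped in cycle 2 (continuation lead c1)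

`stub_kestenDictionary` (cycle 1: `G(η, γ s) ≍ 1/(cp − cm)(ρ_s)` in the bulk, mesh-uniformly) is
now a PROVED composition `kestenDictionary` of four registered stubs:
* (N-lo) `stub_pathPoint_lower`, (N-hi) `stub_pathPoint_upper` — uniform NON-DEGENERACY of the joint
  crossing probability ALONG THE PATH (`v₁ ≤ P_η(γ s) ≤ v₂` for all `s` and all small `η`): provable
  now from `PathOK`'s two-sided box-crossing bounds, FKG for `M_k`
  (`isPositivelyAssociated_selfRefinementMeasure`) and the tube machinery of (D1)
  (`exists_tube_events`; planar duality for the upper bound);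
* (W) `stub_Dc_windowStability` — KESTEN'S STABILITY of `∂cP` across the finite-size window
  `{c : P_η(ρ,c) ∈ [vlo, vhi]}` in the bulk, mesh-uniform (the research kernel, stated canonically);
* (R) `stub_Drho_le_window` — the `ρ`-derivative at bulk path points is at most window size,
  `|∂ρP(γ s)|·(cp − cm)(ρ_s) ≤ Λ₃` (second research kernel);
glued by the MEAN VALUE THEOREM (a window point `ct ∈ (cm, cp)` has
`∂cP(ρ, ct) = (vhi − vlo)/(cp − cm)` exactly) and monotonicity of `P` in `c`. -/

/- (hypothesis `hW`, registered stub `stub_Dc_windowStability`)  **(W) KESTEN'S WINDOW STABILITY FOR `M_k` (open research kernel, canonical form).**  In the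
bulk `ρ ≤ 1 − δ` and for two fixed levels `0 < vlo < vhi < 1`: across the finite-size critical
window `{c ∈ [0,1] : P_η(ρ,c) ∈ [vlo, vhi]}` the Russo derivative `∂cP = Σ_{non-axial e} P(e pivotal)`
varies by at most a MESH-UNIFORM factor `Λ₂` (Kesten 1987, Thm 1/§5 for Bernoulli percolation:
four-arm counts are stable inside the near-critical window; for the 1-dependent `M_k(ρ,·)`, a
monotone Bernoulli family in the independent non-axial coins over the FKG block environment, not
in print; nearest tree fact `Literature.Probability.Percolation.Kesten1987_zdKestenRelation`,
bond-`ℤ²`, unproved). -/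
variable (hW :
    ∀ k : ℕ, k = 2 ∨ k = 3 → ∀ γ : unitInterval → ℝ × ℝ, PathOK k γ →
      ∀ (m : ℕ) (F : Fin m → Quad (Set.univ : Set ℂ)), 0 < m → ∀ δ : ℝ, 0 < δ → δ ≤ 1 / 2 →
        ∀ vlo vhi : ℝ, 0 < vlo → vlo < vhi → vhi < 1 →
          ∃ Λ₂ η₂ : ℝ, 0 < Λ₂ ∧ 0 < η₂ ∧ ∀ η ∈ Set.Ioo 0 η₂, ∀ ρ ∈ Set.Icc (0 : ℝ) (1 - δ),
            ∀ c ∈ Set.Icc (0 : ℝ) 1, ∀ c' ∈ Set.Icc (0 : ℝ) 1,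
              P k m F η ρ c ∈ Set.Icc vlo vhi → P k m F η ρ c' ∈ Set.Icc vlo vhi →
                Dc k m F η (ρ, c) ≤ Λ₂ * Dc k m F η (ρ, c'))

/- (hypothesis `hR`, registered stub `stub_Drho_le_window`)  **(R) THE `ρ`-DERIVATIVE IS AT MOST WINDOW SIZE (open research kernel).**  In the bulk and for
level selections `cm < cp` of `P_η(ρ,·)` at two fixed levels: at the path points,
`|∂ρP(γ s)| · (cp − cm)(ρ_s) ≤ Λ₃` mesh-uniformly (`∂ρP = ¼Σ_blocks E[Δ₁Δ₂ 1_A]` (k = 2) is a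
signed sum of block second differences, each bounded by block-pivotality; block-pivotal counts are
four-arm counts `≍` window⁻¹ by Kesten's relation — for `M_k` not in print). -/
variable (hR :
    ∀ k : ℕ, k = 2 ∨ k = 3 → ∀ γ : unitInterval → ℝ × ℝ, PathOK k γ →
      ∀ (m : ℕ) (F : Fin m → Quad (Set.univ : Set ℂ)), 0 < m → ∀ δ : ℝ, 0 < δ → δ ≤ 1 / 2 →
        ∀ vlo vhi : ℝ, 0 < vlo → vlo < vhi → vhi < 1 →
          ∃ Λ₃ η₃ : ℝ, 0 < Λ₃ ∧ 0 < η₃ ∧ ∀ η ∈ Set.Ioo 0 η₃, ∀ cm cp : ℝ → ℝ,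
            (∀ ρ ∈ Set.Icc (0 : ℝ) (1 - δ), cm ρ ∈ Set.Icc (0 : ℝ) 1 ∧ cp ρ ∈ Set.Icc (0 : ℝ) 1 ∧
                P k m F η ρ (cm ρ) = vlo ∧ P k m F η ρ (cp ρ) = vhi) →
            ∀ s : unitInterval, (γ s).1 ≤ 1 - δ →
              |Dρ k m F η (γ s)| * (cp (γ s).1 - cm (γ s).1) ≤ Λ₃)

include hW hR in
/-- **(DICT) KESTEN'S DICTIONARY ALONG THE PATH (proved composition of (N-lo), (N-hi), (W), (R)).**
In the bulk `ρ ≤ 1 − δ`, for two fixed levels `0 < vlo < vhi < 1`, every small mesh, and any level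
selections `cm`, `cp` of `P_η(ρ,·)` at the two levels inside `[0,1]`:
`G(η, γ s) ≍ 1/(cp − cm)(ρ_s)` at the path points with a MESH-UNIFORM constant `Λ₁`.
Proof: the path point `c_s` lies in the enlarged window `[min vlo v₁, max vhi v₂]` (N-lo/N-hi); by
the mean value theorem some `ct ∈ (cm, cp)` has `∂cP(ρ_s, ct) = (vhi − vlo)/(cp − cm)`; (W) compares
`∂cP(γ s)` with `∂cP(ρ_s, ct)` both ways, and (R) bounds `|∂ρP(γ s)|·(cp − cm)`. -/
theorem kestenDictionary :
    ∀ k : ℕ, k = 2 ∨ k = 3 → ∀ γ : unitInterval → ℝ × ℝ, PathOK k γ →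
      ∀ (m : ℕ) (F : Fin m → Quad (Set.univ : Set ℂ)), 0 < m → ∀ δ : ℝ, 0 < δ → δ ≤ 1 / 2 →
        ∀ vlo vhi : ℝ, 0 < vlo → vlo < vhi → vhi < 1 →
          ∃ Λ₁ η₁ : ℝ, 0 < Λ₁ ∧ 0 < η₁ ∧ ∀ η ∈ Set.Ioo 0 η₁, ∀ cm cp : ℝ → ℝ,
            (∀ ρ ∈ Set.Icc (0 : ℝ) (1 - δ), cm ρ ∈ Set.Icc (0 : ℝ) 1 ∧ cp ρ ∈ Set.Icc (0 : ℝ) 1 ∧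
                P k m F η ρ (cm ρ) = vlo ∧ P k m F η ρ (cp ρ) = vhi) →
            ∀ s : unitInterval, (γ s).1 ≤ 1 - δ →
              |Dρ k m F η (γ s)| + |Dc k m F η (γ s)| ≤ Λ₁ / (cp (γ s).1 - cm (γ s).1) ∧
              1 ≤ Λ₁ * (cp (γ s).1 - cm (γ s).1) * (|Dρ k m F η (γ s)| + |Dc k m F η (γ s)|) := by
  intro k hk γ hγ m F hm δ hδ hδ' vlo vhi hvlo hvv hvhi
  obtain ⟨v₁, η₅, hv₁, hη₅, hlo⟩ := stub_pathPoint_lower k hk γ hγ m F hm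
  obtain ⟨v₂, η₆, hv₂, hη₆, hhi⟩ := stub_pathPoint_upper k hk γ hγ m F hm
  have hVLO0 : 0 < min vlo v₁ := lt_min hvlo hv₁
  have hVV : min vlo v₁ < max vhi v₂ :=
    lt_of_le_of_lt (min_le_left _ _) (lt_of_lt_of_le hvv (le_max_left _ _))
  have hVHI1 : max vhi v₂ < 1 := max_lt hvhi hv₂
  obtain ⟨Λ₂, η₂, hΛ₂, hη₂, hW⟩ :=
    hW k hk γ hγ m F hm δ hδ hδ' (min vlo v₁) (max vhi v₂) hVLO0 hVV hVHI1
  obtain ⟨Λ₃, η₃, hΛ₃, hη₃, hR⟩ := hR k hk γ hγ m F hm δ hδ hδ' vlo vhi hvlo hvv hvhi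
  have hdv : 0 < vhi - vlo := sub_pos.2 hvv
  refine ⟨max (Λ₃ + Λ₂ * (vhi - vlo)) (Λ₂ / (vhi - vlo)), min (min η₅ η₆) (min η₂ η₃),
    lt_max_of_lt_right (div_pos hΛ₂ hdv), lt_min (lt_min hη₅ hη₆) (lt_min hη₂ hη₃), ?_⟩
  intro η hη cm cp hsel s hs
  have hη5 : η ∈ Set.Ioo 0 η₅ :=
    ⟨hη.1, lt_of_lt_of_le hη.2 ((min_le_left _ _).trans (min_le_left _ _))⟩
  have hη6 : η ∈ Set.Ioo 0 η₆ :=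
    ⟨hη.1, lt_of_lt_of_le hη.2 ((min_le_left _ _).trans (min_le_right _ _))⟩
  have hη2 : η ∈ Set.Ioo 0 η₂ :=
    ⟨hη.1, lt_of_lt_of_le hη.2 ((min_le_right _ _).trans (min_le_left _ _))⟩
  have hη3 : η ∈ Set.Ioo 0 η₃ :=
    ⟨hη.1, lt_of_lt_of_le hη.2 ((min_le_right _ _).trans (min_le_right _ _))⟩
  have hη0 : η ≠ 0 := hη.1.ne'
  -- the path point `(ρ_s, c_s)` lies in the square, `ρ_s` in the bulk
  have hsq := hγ.2.2.2.1 s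
  have hρI : (γ s).1 ∈ Set.Icc (0 : ℝ) (1 - δ) := ⟨hsq.1.1, hs⟩
  have hρ01 : (γ s).1 ∈ Set.Icc (0 : ℝ) 1 := hsq.1
  have hc01 : (γ s).2 ∈ Set.Icc (0 : ℝ) 1 := hsq.2
  obtain ⟨hcm01, hcp01, hPm, hPp⟩ := hsel (γ s).1 hρI
  -- `cm < cp` from `vlo < vhi` and monotonicity
  have hlt : cm (γ s).1 < cp (γ s).1 := by
    by_contra hle
    rw [not_lt] at hle
    have := P_mono_c k m F hη0 (γ s).1 hle
    rw [hPm, hPp] at this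
    linarith
  have hgap : 0 < cp (γ s).1 - cm (γ s).1 := sub_pos.2 hlt
  -- mean value theorem: a window point `ct` with `∂cP(ρ_s, ct) = (vhi - vlo)/(cp - cm)`
  obtain ⟨Φ, hΦ, hPΦ⟩ := exists_contDiff_eq_P k m F hη0
  have hΦd : Differentiable ℝ Φ := hΦ.differentiable (by norm_num)
  have hg : ∀ x : ℝ, HasDerivAt (fun x : ℝ => Φ ((γ s).1, x)) (fderiv ℝ Φ ((γ s).1, x) (0, 1)) x :=
    fun x => (hΦd ((γ s).1, x)).hasFDerivAt.comp_hasDerivAt x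
      ((hasDerivAt_const x (γ s).1).prodMk (hasDerivAt_id x))
  obtain ⟨ct, hct, hslope⟩ := exists_hasDerivAt_eq_slope (fun x : ℝ => Φ ((γ s).1, x))
    (fun x => fderiv ℝ Φ ((γ s).1, x) (0, 1)) hlt
    (fun x _ => (hg x).continuousAt.continuousWithinAt) (fun x _ => hg x)
  have hct01 : ct ∈ Set.Icc (0 : ℝ) 1 := ⟨hcm01.1.trans hct.1.le, hct.2.le.trans hcp01.2⟩
  have hDct : Dc k m F η ((γ s).1, ct) = (vhi - vlo) / (cp (γ s).1 - cm (γ s).1) := by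
    have h1 : Dc k m F η ((γ s).1, ct) = fderiv ℝ Φ ((γ s).1, ct) (0, 1) :=
      derivWithin_eq_fderiv_snd (hΦd ((γ s).1, ct)) hct01 (fun c' hc' => hPΦ (γ s).1 hρ01 c' hc')
    rw [h1, hslope, ← hPΦ (γ s).1 hρ01 _ hcp01, ← hPΦ (γ s).1 hρ01 _ hcm01, hPp, hPm]
  -- both `c_s` and `ct` lie in the enlarged window
  have hPct : P k m F η (γ s).1 ct ∈ Set.Icc (min vlo v₁) (max vhi v₂) := by
    refine ⟨?_, ?_⟩
    · calc min vlo v₁ ≤ vlo := min_le_left _ _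
        _ = P k m F η (γ s).1 (cm (γ s).1) := hPm.symm
        _ ≤ P k m F η (γ s).1 ct := P_mono_c k m F hη0 (γ s).1 hct.1.le
    · calc P k m F η (γ s).1 ct ≤ P k m F η (γ s).1 (cp (γ s).1) := P_mono_c k m F hη0 (γ s).1 hct.2.le
        _ = vhi := hPp
        _ ≤ max vhi v₂ := le_max_left _ _
  have hPc : P k m F η (γ s).1 (γ s).2 ∈ Set.Icc (min vlo v₁) (max vhi v₂) :=
    ⟨(min_le_right _ _).trans (hlo η hη5 s), (hhi η hη6 s).trans (le_max_right _ _)⟩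
  have hW1 := hW η hη2 (γ s).1 hρI (γ s).2 hc01 ct hct01 hPc hPct
  have hW2 := hW η hη2 (γ s).1 hρI ct hct01 (γ s).2 hc01 hPct hPc
  have hR1 := hR η hη3 cm cp hsel s hs
  rw [hDct] at hW1 hW2
  -- `hW1 : Dc(γ s) ≤ Λ₂ (vhi - vlo)/(cp - cm)`, `hW2 : (vhi - vlo)/(cp - cm) ≤ Λ₂ Dc(γ s)`
  have eDc : Dc k m F η (γ s) = Dc k m F η ((γ s).1, (γ s).2) := rfl
  set G := |Dρ k m F η (γ s)| + |Dc k m F η (γ s)| with hGdef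
  set W := cp (γ s).1 - cm (γ s).1 with hWdef
  have hslope_pos : 0 < (vhi - vlo) / W := div_pos hdv hgap
  have hDc_pos : 0 < Dc k m F η ((γ s).1, (γ s).2) := by
    by_contra hle
    rw [not_lt] at hle
    nlinarith [mul_nonpos_of_nonneg_of_nonpos hΛ₂.le hle]
  have habsDc : |Dc k m F η (γ s)| = Dc k m F η ((γ s).1, (γ s).2) := by
    rw [eDc]; exact abs_of_pos hDc_pos
  have hGW : G * W ≤ Λ₃ + Λ₂ * (vhi - vlo) := by
    have h1 : |Dc k m F η (γ s)| * W ≤ Λ₂ * (vhi - vlo) := by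
      rw [habsDc]
      calc Dc k m F η ((γ s).1, (γ s).2) * W ≤ Λ₂ * ((vhi - vlo) / W) * W :=
            mul_le_mul_of_nonneg_right hW1 hgap.le
        _ = Λ₂ * (vhi - vlo) := by field_simp
    have h2 : |Dρ k m F η (γ s)| * W ≤ Λ₃ := hR1
    calc G * W = |Dρ k m F η (γ s)| * W + |Dc k m F η (γ s)| * W := by rw [hGdef]; ring
      _ ≤ Λ₃ + Λ₂ * (vhi - vlo) := by linarith
  have hGlow : vhi - vlo ≤ Λ₂ * (W * G) := by
    have h1 : (vhi - vlo) / W ≤ Λ₂ * G := by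
      calc (vhi - vlo) / W ≤ Λ₂ * Dc k m F η ((γ s).1, (γ s).2) := hW2
        _ = Λ₂ * |Dc k m F η (γ s)| := by rw [habsDc]
        _ ≤ Λ₂ * G := by
            gcongr
            rw [hGdef]
            linarith [abs_nonneg (Dρ k m F η (γ s))]
    rw [div_le_iff₀ hgap] at h1
    linarith
  constructor
  · rw [le_div_iff₀ hgap]
    exact hGW.trans (le_max_left _ _)
  · have h1 : Λ₂ / (vhi - vlo) ≤ max (Λ₃ + Λ₂ * (vhi - vlo)) (Λ₂ / (vhi - vlo)) := le_max_right _ _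
    have hWG : 0 ≤ W * G := mul_nonneg hgap.le (by positivity)
    have h2 : 1 ≤ Λ₂ / (vhi - vlo) * (W * G) := by
      rw [div_mul_eq_mul_div, le_div_iff₀ hdv, one_mul]
      exact hGlow
    calc (1 : ℝ) ≤ Λ₂ / (vhi - vlo) * (W * G) := h2
      _ ≤ max (Λ₃ + Λ₂ * (vhi - vlo)) (Λ₂ / (vhi - vlo)) * (W * G) :=
          mul_le_mul_of_nonneg_right h1 hWG
      _ = max (Λ₃ + Λ₂ * (vhi - vlo)) (Λ₂ / (vhi - vlo)) * W * G := by ring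

include hW hR in
/-- **Kesten window along the path (proved composition of BV ⨉ POS ⨉ DICT).** -/
theorem kestenWindowAlongPath :
    ∀ k : ℕ, k = 2 ∨ k = 3 → ∀ γ : unitInterval → ℝ × ℝ, PathOK k γ →
      ∀ (m : ℕ) (F : Fin m → Quad (Set.univ : Set ℂ)), 0 < m → ∀ δ : ℝ, 0 < δ → δ ≤ 1 / 2 →
        ∀ vlo vhi : ℝ, 0 < vlo → vlo < vhi → vhi < 1 →
          ∃ Λ₁ η₁ : ℝ, 0 < Λ₁ ∧ 0 < η₁ ∧ ∀ η ∈ Set.Ioo 0 η₁,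
            (∀ ρ ∈ Set.Icc (0 : ℝ) (1 - δ), P k m F η ρ 0 < vlo ∧ vhi < P k m F η ρ 1) ∧
            (∀ ρ ∈ Set.Icc (0 : ℝ) (1 - δ), ∀ c ∈ Set.Icc (0 : ℝ) 1,
                P k m F η ρ c ∈ Set.Icc vlo vhi → 0 < Dc k m F η (ρ, c)) ∧
            ∀ cm cp : ℝ → ℝ,
              (∀ ρ ∈ Set.Icc (0 : ℝ) (1 - δ), cm ρ ∈ Set.Icc (0 : ℝ) 1 ∧ cp ρ ∈ Set.Icc (0 : ℝ) 1 ∧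
                  P k m F η ρ (cm ρ) = vlo ∧ P k m F η ρ (cp ρ) = vhi) →
              ∀ s : unitInterval, (γ s).1 ≤ 1 - δ →
                |Dρ k m F η (γ s)| + |Dc k m F η (γ s)| ≤ Λ₁ / (cp (γ s).1 - cm (γ s).1) ∧
                1 ≤ Λ₁ * (cp (γ s).1 - cm (γ s).1) * (|Dρ k m F η (γ s)| + |Dc k m F η (γ s)|) := by
  intro k hk γ hγ m F hm δ hδ hδ' vlo vhi hvlo hvv hvhi
  obtain ⟨η₁, hη₁, hBV⟩ := stub_boundaryValues k hk γ hγ m F hm δ hδ hδ' vlo vhi hvlo hvv hvhi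
  obtain ⟨Λ₁, η₂, hΛ₁, hη₂, hD⟩ := kestenDictionary hW hR k hk γ hγ m F hm δ hδ hδ' vlo vhi hvlo hvv hvhi
  refine ⟨Λ₁, min η₁ η₂, hΛ₁, lt_min hη₁ hη₂, fun η hη => ⟨?_, ?_, ?_⟩⟩
  · exact hBV η ⟨hη.1, lt_of_lt_of_le hη.2 (min_le_left _ _)⟩
  · intro ρ hρ c hc hband
    have hη1 : η ∈ Set.Ioo 0 η₁ := ⟨hη.1, lt_of_lt_of_le hη.2 (min_le_left _ _)⟩
    have hη0 : η ≠ 0 := hη.1.ne'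
    obtain ⟨h0, h1⟩ := hBV η hη1 ρ hρ
    have hρ01 : ρ ∈ Set.Icc (0 : ℝ) 1 := ⟨hρ.1, by linarith [hρ.2]⟩
    -- `c` is interior: at `c = 0`, `1` the value would leave the band
    have hc0 : c ≠ 0 := by rintro rfl; linarith [hband.1]
    have hc1 : c ≠ 1 := by rintro rfl; linarith [hband.2]
    have hcI : c ∈ Set.Ioo (0 : ℝ) 1 := ⟨lt_of_le_of_ne hc.1 (Ne.symm hc0), lt_of_le_of_ne hc.2 hc1⟩
    refine stub_Dc_pos_of_nonconstant k m F hη0 hρ01 hcI ?_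
    intro hconst
    have := hconst 0 ⟨le_rfl, zero_le_one⟩
    linarith [hband.1]
  · exact hD η ⟨hη.1, lt_of_lt_of_le hη.2 (min_le_right _ _)⟩

end Summit.CriticalPhenomena.CardyFormulaZ2.Theorems.CardySelfRefinement

end
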